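import Literature.AnabelianGeometry.AbsoluteAnabelian.AutHolomorphicSpacesDiscProofs
import Literature.AnabelianGeometry.AbsoluteAnabelian.AutHolomorphicSpacesChartDiscProofs
import Literature.AnabelianGeometry.AbsoluteAnabelian.CoorientationsProofs
import Literature.AnabelianGeometry.AbsoluteAnabelian.AbsTopIII.RemarksArchimedeanLocalProofs
import HarnessLib

/-!
# [AbsTopIII] Cor. 2.3 (i) DISCHARGED: local morphisms of Aut-holomorphic spaces are RC-holomorphic

PROOF-ONLY companion of `AutHolomorphicSpaces` (owner module, abc-iut L4-t2): kernel proof of the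
named `Prop` fact `LocalMorphismIsRCHolomorphic` — S. Mochizuki, *Topics in absolute anabelian
geometry III*, Cor. 2.3 (i) p.53: for Riemann surfaces `X`, `Y` with local structures `𝒰`, `𝒱`,
"every `(𝒰,𝒱)`-local morphism of Aut-holomorphic spaces `φ : 𝕏 → 𝕐` arises from a unique étale
RC-holomorphic morphism `ψ : X → Y`" (as typed: the underlying local homeomorphism `φ` is
RC-holomorphic).

Route — the printed one ("follows immediately from the definitions, by applying Proposition 2.2,
(i), to sufficiently small open discs in `X^top`", p.53), made honest in the kernel: around
`x ∈ X` choose a chart disc `D ∈ 𝒰` on which `φ` is injective and whose image `V = φ(D)` lies in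
a member of `𝒱` inside a chart domain of `Y` with bounded chart image; `V ∈ 𝒱` is an open simply
connected proper subset of `ℂ` in that chart, hence a disc by the TREE's Riemann mapping theorem;
the local-morphism property at `(D, V)` says that `φ|_D` conjugates biholomorphic automorphisms of
`D` to biholomorphic automorphisms of `V`, so the transport statement of
`AutHolomorphicSpacesDiscProofs` (Prop. 2.2 (i), via the normaliser of `Aut(𝔻)` in `Homeo(𝔻)`)
shows that `φ|_D` is a Möbius or anti-Möbius map in the disc coordinates, i.e. `φ` is holomorphic
or anti-holomorphic near `x`.

HONEST FRAMING: our kernel check of a classical statement of a refereed paper; nothing here bears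
on [IUTchIII] Cor. 3.12.  Bib key `MochizukiAbsTopIII2015`; locators = kurims manuscript pages.
-/

noncomputable section

namespace Literature.AnabelianGeometry.AbsoluteAnabelian

open _root_.TopologicalSpace _root_.Topology _root_.Set _root_.Metric _root_.Function _root_.Filter
open scoped _root_.Manifold _root_.ContDiff ComplexConjugate
open Literature.Analysis.Complex

section Local

variable {X Y : Type} [TopologicalSpace X] [ChartedSpace ℂ X] [IsManifold 𝓘(ℂ, ℂ) ω X]
  [TopologicalSpace Y] [ChartedSpace ℂ Y] [IsManifold 𝓘(ℂ, ℂ) ω Y]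

/-- **Cor. 2.3 (i), pointwise**: a `(𝒰,𝒱)`-local morphism of the Aut-holomorphic spaces of two
Riemann surfaces is holomorphic or anti-holomorphic at each point.
[cite: MochizukiAbsTopIII2015, Corollary 2.3 (i) p.53] -/
theorem isHolAt_or_isAntiHolAt_of_isLocalMorphism {𝒰 : Set (Opens X)} {𝒱 : Set (Opens Y)}
    (h𝒰 : IsLocalStructure X 𝒰) (h𝒱 : IsLocalStructure Y 𝒱) {φ : X → Y}
    (hφ : IsLocalMorphism (AutHolStructure.ofCharted X) (AutHolStructure.ofCharted Y) 𝒰 𝒱 φ)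
    (x : X) : IsHolAt φ x ∨ IsAntiHolAt φ x := by
  -- `φ` is an open partial homeomorphism `g` near `x`
  obtain ⟨g, hxg, hφg⟩ := hφ.isLocalHomeomorph x
  set cY := chartAt ℂ (φ x) with hcY
  -- a member `V₀ ∈ 𝒱` around `φ x`, inside the chart domain, with chart image in a ball
  set W : Set Y := cY.source ∩ cY ⁻¹' ball (cY (φ x)) 1 with hW
  have hWo : IsOpen W := cY.isOpen_inter_preimage isOpen_ball
  have hxW : φ x ∈ W := ⟨mem_chart_source ℂ (φ x), by
    show cY (φ x) ∈ ball (cY (φ x)) 1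
    exact mem_ball_self one_pos⟩
  obtain ⟨V₀, hV₀𝒱, hxV₀, hV₀W⟩ :=
    Opens.isBasis_iff_nbhd.1 h𝒱.isBasis (show φ x ∈ (⟨W, hWo⟩ : Opens Y) from hxW)
  -- a member `U₀ ∈ 𝒰` around `x`, inside `g.source ∩ φ⁻¹ V₀`
  set W' : Set X := g.source ∩ φ ⁻¹' (V₀ : Set Y) with hW'
  have hW'o : IsOpen W' := by
    rw [hW', hφg]
    exact g.isOpen_inter_preimage V₀.isOpen
  have hxW' : x ∈ W' := ⟨hxg, hxV₀⟩
  obtain ⟨U₀, hU₀𝒰, hxU₀, hU₀W'⟩ :=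
    Opens.isBasis_iff_nbhd.1 h𝒰.isBasis (show x ∈ (⟨W', hW'o⟩ : Opens X) from hxW')
  -- the chart disc `D ∈ 𝒰`
  obtain ⟨D, eD, hxD, hDU₀, hDconn, heD, heDs⟩ := exists_chartDisc x U₀.isOpen hxU₀
  have hD𝒰 : D ∈ 𝒰 := h𝒰.mem_of_le U₀ hU₀𝒰 D hDconn hDU₀
  have hDg : (D : Set X) ⊆ g.source := fun p hp => (hU₀W' (hDU₀ hp)).1
  have hDV₀ : ∀ {p : X}, p ∈ D → φ p ∈ V₀ := fun hp => (hU₀W' (hDU₀ hp)).2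
  -- its image `V = φ(D) ∈ 𝒱`
  obtain ⟨V, e, hVg, he⟩ := exists_opens_image_homeomorph g D hDg
  have heφ : ∀ p : D, (e p : Y) = φ p := fun p => by rw [he, hφg]
  have hVconn : IsConnected (V : Set Y) := by
    rw [hVg]
    exact hDconn.image _ (g.continuousOn.mono hDg)
  have hVV₀ : V ≤ V₀ := by
    intro q hq
    rw [← SetLike.mem_coe, hVg] at hq
    obtain ⟨p, hp, rfl⟩ := hq
    rw [← hφg]
    exact hDV₀ hp
  have hV𝒱 : V ∈ 𝒱 := h𝒱.mem_of_le V₀ hV₀𝒱 V hVconn hVV₀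
  -- `V` is a Riemann-mapping disc
  have hVs : (V : Set Y) ⊆ cY.source := fun q hq => (hV₀W (hVV₀ hq)).1
  have hVb : cY '' (V : Set Y) ⊆ ball (cY (φ x)) 1 := by
    rintro _ ⟨q, hq, rfl⟩
    exact (hV₀W (hVV₀ hq)).2
  obtain ⟨eV, heV, heVs⟩ := exists_discParam_of_subset_source (chart_mem_atlas ℂ (φ x)) V hVs hVb
    ⟨e.symm.trans eD⟩
  -- the local-morphism property at `(D, V)`: `e` conjugates `Aut^hol(D)` onto `Aut^hol(V)`
  have hmap := hφ.map_aut_eq ⟨D, hDconn⟩ ⟨V, hVconn⟩ hD𝒰 hV𝒱 e heφ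
  have hconj : ∀ ψ : D ≃ₜ D, MDifferentiable 𝓘(ℂ, ℂ) 𝓘(ℂ, ℂ) ψ →
      MDifferentiable 𝓘(ℂ, ℂ) 𝓘(ℂ, ℂ) ψ.symm →
      MDifferentiable 𝓘(ℂ, ℂ) 𝓘(ℂ, ℂ) (e.symm.trans (ψ.trans e)) ∧
        MDifferentiable 𝓘(ℂ, ℂ) 𝓘(ℂ, ℂ) (e.symm.trans (ψ.symm.trans e)) := by
    intro ψ hψ hψs
    have hmem : ψ ∈ holAut D := (mem_holAut_iff ψ).2 ⟨hψ, hψs⟩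
    have h' : homeoConj e ψ ∈ holAut V := by
      have : homeoConj e ψ ∈ ((AutHolStructure.ofCharted X).aut ⟨D, hDconn⟩).map
          (homeoConj e).toMonoidHom := Subgroup.mem_map_of_mem _ hmem
      rwa [hmap] at this
    exact (mem_holAut_iff _).1 h'
  obtain ⟨c, a, hc, ha, hcase⟩ := exists_discRot_of_transport eD heD heDs eV heV heVs e hconj
  set H := eD.symm.trans (e.trans eV) with hH
  have hφH : ∀ p : D, φ p = ((eV.symm (H (eD p)) : V) : Y) := by
    intro p; rw [← heφ]; simp [hH]
  have hDnhds : ∀ {y : X}, y ∈ D → (D : Set X) ∈ 𝓝 y := fun hy => D.isOpen.mem_nhds hy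
  rcases hcase with hhol | hanti
  · -- holomorphic on `D`
    left
    have hHd : MDifferentiable 𝓘(ℂ, ℂ) 𝓘(ℂ, ℂ) H :=
      mdifferentiable_of_differentiableOn (isDiscAut_discRot hc ha).differentiableOn hhol
    have hed : MDifferentiable 𝓘(ℂ, ℂ) 𝓘(ℂ, ℂ) e := by
      have : (⇑e) = eV.symm ∘ H ∘ eD := funext fun p => by simp [hH]
      rw [this]
      exact heVs.comp (hHd.comp heD)
    refine Filter.eventually_of_mem (hDnhds hxD) fun y hy => ?_
    exact (mdifferentiableAt_opens_iff (Ψ := e) (Φ := φ) heφ ⟨y, hy⟩).1 (hed _)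
  · -- anti-holomorphic on `D`
    right
    have hRm : MapsTo (discRot c a) (ball 0 1) (ball 0 1) := (isDiscAut_discRot hc ha).mapsTo
    set E : X → unitDiscOpens := Function.extend Subtype.val eD fun _ => ⟨0, mem_ball_self one_pos⟩
      with hE
    set S : unitDiscOpens → Y := Subtype.val ∘ eV.symm with hS
    have hSd : MDifferentiable 𝓘(ℂ, ℂ) 𝓘(ℂ, ℂ) S := fun u =>
      (mdifferentiableAt_opens_cod_iff (Ψ := eV.symm) u).1 (heVs u)
    have hloc : ∀ {p : X} (hp : p ∈ D), φ p = S ⟨discRot c a (conj (E p : ℂ)),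
        hRm (conj_mem_unitBall (E p).2)⟩ := by
      intro p hp
      rw [hφH ⟨p, hp⟩, hS, comp_apply]
      congr 2
      apply Subtype.ext
      rw [hanti (eD ⟨p, hp⟩), hE, extend_subtype_apply (U := D) eD _ hp]
    refine Filter.eventually_of_mem (hDnhds hxD) fun y hy => ⟨?_, ?_⟩
    · rw [hφg]; exact g.continuousAt (hDg hy)
    · exact differentiableAt_conj_writtenInExtChartAt_of_eventually φ y E
        (mdifferentiableAt_extend_subtype (U := D) eD _ hy (heD _)) S hSd
        (isDiscAut_discRot hc ha).differentiableOn hRm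
        (Filter.eventually_of_mem (hDnhds hy) fun p hp => hloc hp)

end Local

/-- **[AbsTopIII] Cor. 2.3 (i) holds as typed** (`LocalMorphismIsRCHolomorphic` DISCHARGED): for
Riemann surfaces `X`, `Y` with local structures `𝒰`, `𝒱`, every `(𝒰,𝒱)`-local morphism of the
associated Aut-holomorphic spaces is RC-holomorphic.
[cite: MochizukiAbsTopIII2015, Corollary 2.3 (i) p.53] -/
theorem localMorphismIsRCHolomorphic_holds : LocalMorphismIsRCHolomorphic := by
  intro X Y _ _ _ _ _ _ _ _ 𝒰 𝒱 h𝒰 h𝒱 φ hφ x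
  exact isHolAt_or_isAntiHolAt_of_isLocalMorphism h𝒰 h𝒱 hφ x

/-- `LocalMorphismIsRCHolomorphic` — `_holds` alias of `localMorphismIsRCHolomorphic_holds` above under the fact's exact name (appended
2026-08-28, D-0026 bookkeeping: the proof term is the existing theorem of this file; no statement,
definition or attribute is edited; no new named fact; the ledger's debt table listed the fact
unproved). [cite: MochizukiAbsTopIII2015, Corollary 2.3 (i) p.53] -/
theorem _root_.Literature.AnabelianGeometry.AbsoluteAnabelian.LocalMorphismIsRCHolomorphic_holds :
    LocalMorphismIsRCHolomorphic :=
  _root_.Literature.AnabelianGeometry.AbsoluteAnabelian.localMorphismIsRCHolomorphic_holds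

/-! ### Consequences handed over by their typers (one-liners over `localMorphismIsRCHolomorphic_holds`) -/

/-- **[AbsTopIII] Cor. 2.3 (i), second sentence, DISCHARGED**: "there are precisely 2 co-holomorphicizations
`𝕏 → 𝕐`, corresponding to the holomorphic and anti-holomorphic local isomorphisms" — t2's
`TwoCoHolomorphicizations` (conditional proof `twoCoHolomorphicizations_of_localMorphismIsRCHolomorphic`
in `CoorientationsProofs`) made unconditional. [cite: MochizukiAbsTopIII2015, Corollary 2.3 (i) p.53] -/
theorem twoCoHolomorphicizations_holds : TwoCoHolomorphicizations :=
  twoCoHolomorphicizations_of_localMorphismIsRCHolomorphic localMorphismIsRCHolomorphic_holds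

/-- `TwoCoHolomorphicizations` — `_holds` alias of `twoCoHolomorphicizations_holds` above under the fact's exact name (appended
2026-08-28, D-0026 bookkeeping: the proof term is the existing theorem of this file; no statement,
definition or attribute is edited; no new named fact; the ledger's debt table listed the fact
unproved). [cite: MochizukiAbsTopIII2015, Corollary 2.3 (i) p.53] -/
theorem _root_.Literature.AnabelianGeometry.AbsoluteAnabelian.TwoCoHolomorphicizations_holds :
    TwoCoHolomorphicizations :=
  _root_.Literature.AnabelianGeometry.AbsoluteAnabelian.twoCoHolomorphicizations_holds

/-- **[AbsTopIII] Rmk. 2.3.2 DISCHARGED**: the co-holomorphicization of a local morphism does not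
depend on the local structures `𝒰`, `𝒱` — t14's `AbsTopIII.Rmk_2_3_2` (conditional proof
`rmk_2_3_2_of_localMorphismIsRCHolomorphic` by t8 in `AbsTopIII.RemarksArchimedeanLocalProofs`) made
unconditional. [cite: MochizukiAbsTopIII2015, Remark 2.3.2 p.54] -/
theorem rmk_2_3_2_holds : AbsTopIII.Rmk_2_3_2 :=
  rmk_2_3_2_of_localMorphismIsRCHolomorphic localMorphismIsRCHolomorphic_holds

/-- `Rmk_2_3_2` — `_holds` alias of `rmk_2_3_2_holds` above under the fact's exact name (appended
2026-08-28, D-0026 bookkeeping: the proof term is the existing theorem of this file; no statement,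
definition or attribute is edited; no new named fact; the ledger's debt table listed the fact
unproved). [cite: MochizukiAbsTopIII2015, Remark 2.3.2 p.54] -/
theorem _root_.Literature.AnabelianGeometry.AbsoluteAnabelian.AbsTopIII.Rmk_2_3_2_holds :
    AbsTopIII.Rmk_2_3_2 :=
  _root_.Literature.AnabelianGeometry.AbsoluteAnabelian.rmk_2_3_2_holds

end Literature.AnabelianGeometry.AbsoluteAnabelian
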